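import Literature.Analysis.FluidPDE.SereginSverakProbeEnergyNoJump
import Literature.Analysis.FluidPDE.SereginSverakWindowHolder
import Literature.Analysis.FluidPDE.SereginSverakScaledEnergiesAtVertex
import Literature.Analysis.FluidPDE.SereginSverakOneScaleSmallness
import HarnessLib

/-!
# One-sided pressure bounds: at a singular point of the final time the probe energy stays
# large on whole parabolic windows, at every small scale

Analysis/FluidPDE proof file (theorems only; no definitions, no named facts) on the discharge
path of the named fact `Literature.Analysis.FluidPDE.seregin_sverak_2002`
(`SereginSverakPressure.lean`; G. Seregin, V. Šverák, *Navier–Stokes equations with lower bounds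
on the pressure*, Arch. Ration. Mech. Anal. **163** (2002) 65–86, main theorem; the text of the
paper is cite-only on this hub, the argument below is the tree's own reconstruction of the
"largeness propagates backward over parabolic windows" step of the blow-up analysis of §3–4).

Setting: a classical solution of the Navier–Stokes system on `[0, T) × ℝ³` (`ν = 1`) which is
Leray–Hopf on `[0, T]`, with `|u|²/2 + p̃ ≤ K` or `p̃ ≥ -K` on `(0, T) × ℝ³`, a probe pair
`(P, P̄)` and the probe energy `F(r; x₀, t) = ∫ |u(t)|² r⁻¹ P̄(|x - x₀|²/r²)`.

* `SereginSverak2002.probeEnergy_ge_on_final_windows` — **the theorem**: with the universal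
  `δ = δ(P, P̄) > 0` of `frequently_probeEnergy_gt_of_not_isBackwardBoundedAt`
  (`SereginSverakOneScaleSmallness.lean`: if `(T, x₀)` is not backward bounded then
  `F(r; x₀, t) > δ` at times `t` arbitrarily close to `T`, for every small `r`), for every such
  solution and every `x₀` with `¬ IsBackwardBoundedAt u T x₀` there are `θ > 0` and `r₀ > 0`
  such that `F(r; x₀, t) ≥ δ/2` for **all** `t ∈ (T - θ²r², T)` and all `0 < r ≤ r₀`.

The proof combines the contrapositive of Lemma 3.3 just quoted with the window estimate
`SereginSverak2002.probeEnergy_sub_le_window` (`SereginSverakProbeEnergyNoJump.lean`):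
`F(r; t₁) − F(r; t₀) ≤ L⁻² F(Lr; t₁) + ν (C/r³) a (t₁ − t₀) + (C/r²)(m₃ + 2 m_{pu})`, whose
right-hand side is made `≤ δ/2` uniformly over windows `T − θ²r² < t₀ ≤ t₁ < T` by

* the uniform bound `F ≤ ‖u(0)‖₂² + 4πK =: M_F` at scales `≤ 1`
  (`probeEnergy_le_uniform`) and the choice `L ≥ 8 M_F/δ` for the tail;
* the Type I bound on the ball energies `a = 2 M_F · 3Lr` (`setIntegral_ball_norm_sq_le_uniform`),
  giving `3 C L (2M_F) θ²` for the Laplacian term;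
* the scale-invariant vertex bounds `∬_{Q_ρ(T,x₀)} |u|^{10/3} ≤ K₁ ρ^{5/3}`,
  `∬_{Q_ρ(T,x₀)} |q|^{3/2} ≤ K₁ ρ²` (`exists_vertex_bounds`,
  `SereginSverakScaledEnergiesAtVertex.lean`, for the gauged pressure `q`) on the cylinder
  `Q_{4Lr}(T, x₀) ⊇ (t₀, t₁) × B(x₀, 3Lr)`, turned by Hölder on the window
  (`SereginSverakWindowHolder.lean`) into `m₃ ≤ c₃ θ^{1/5} r²`, `m_{pu} ≤ c₄ θ^{1/15} r²` — the
  smallness coming from the measure `θ² r² |B_{3Lr}|` of the window;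
* and the elementary real-variable step `le_of_frequently_gt_of_window`.

The constants are explicit but immaterial; only `δ` is universal (it depends on the probe pair).

## References

* G. Seregin, V. Šverák, Arch. Ration. Mech. Anal. 163 (2002), 65–86 (the result served).
  [SereginSverak2002]
* L. Caffarelli, R. Kohn, L. Nirenberg, CPAM 35 (1982), §2 (local energy inequality).
  [CaffarelliKohnNirenberg1982]
-/

noncomputable section

open _root_.MeasureTheory Set Function Filter _root_.Topology Metric Real
open scoped NNReal ENNReal RealInnerProductSpace ContDiff

namespace Literature.Analysis.FluidPDE

namespace SereginSverak2002

variable {P Pb : ℝ → ℝ}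

/-! ### Windows inside backward cylinders, their measure, and exponent bookkeeping -/

/-- A window `(t₀, t₁) × B(x₀, R)` with `T − R'² ≤ t₀`, `t₁ ≤ T`, `R ≤ R'` lies in the backward
cylinder `Q_{R'}(T, x₀)`. [folklore] -/
theorem window_subset_parabolicCylinder {t₀ t₁ T R R' : ℝ} (x₀ : EuclideanSpace ℝ (Fin 3))
    (ht₀ : T - R' ^ 2 ≤ t₀) (ht₁ : t₁ ≤ T) (hR : R ≤ R') :
    Ioo t₀ t₁ ×ˢ ball x₀ R ⊆ parabolicCylinder R' (T, x₀) := by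
  rw [parabolicCylinder]
  exact prod_mono (Ioo_subset_Ioo ht₀ ht₁) (ball_subset_ball hR)

/-- `|(t₀, t₁) × B(x₀, R)| = (t₁ − t₀) R³ |B₁|`. [folklore] -/
theorem volume_real_window {t₀ t₁ R : ℝ} (ht : t₀ ≤ t₁) (hR : 0 ≤ R)
    (x₀ : EuclideanSpace ℝ (Fin 3)) :
    volume.real (Ioo t₀ t₁ ×ˢ ball x₀ R) =
      (t₁ - t₀) * (R ^ 3 * volume.real (ball (0 : EuclideanSpace ℝ (Fin 3)) 1)) := by
  rw [measureReal_def, measureReal_def, Measure.volume_eq_prod, Measure.prod_prod, Real.volume_Ioo,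
    Measure.addHaar_ball volume x₀ hR, finrank_euclideanSpace_fin, ENNReal.toReal_mul,
    ENNReal.toReal_mul, ENNReal.toReal_ofReal (by linarith), ENNReal.toReal_ofReal (by positivity)]

/-- `(θ² r⁵ c)^{1/10} (k r^{5/3})^{9/10} = c^{1/10} k^{9/10} θ^{1/5} r²`. [folklore] -/
theorem rpow_bookkeeping_m₃ {θ r c k : ℝ} (hθ : 0 ≤ θ) (hr : 0 < r) (hc : 0 ≤ c) (hk : 0 ≤ k) :
    (θ ^ 2 * r ^ 5 * c) ^ (1 / 10 : ℝ) * (k * r ^ (5 / 3 : ℝ)) ^ (9 / 10 : ℝ) =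
      c ^ (1 / 10 : ℝ) * k ^ (9 / 10 : ℝ) * θ ^ (1 / 5 : ℝ) * r ^ 2 := by
  have hr0 : 0 ≤ r := hr.le
  have h1 : (θ ^ 2 : ℝ) ^ (1 / 10 : ℝ) = θ ^ (1 / 5 : ℝ) := by
    rw [← Real.rpow_natCast θ 2, ← Real.rpow_mul hθ]; norm_num
  have h2 : (r ^ 5 : ℝ) ^ (1 / 10 : ℝ) = r ^ (1 / 2 : ℝ) := by
    rw [← Real.rpow_natCast r 5, ← Real.rpow_mul hr0]; norm_num
  have h3 : (r ^ (5 / 3 : ℝ)) ^ (9 / 10 : ℝ) = r ^ (3 / 2 : ℝ) := by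
    rw [← Real.rpow_mul hr0]; norm_num
  have h4 : r ^ (1 / 2 : ℝ) * r ^ (3 / 2 : ℝ) = r ^ 2 := by
    rw [← Real.rpow_add hr, show (1 / 2 : ℝ) + 3 / 2 = 2 by norm_num, Real.rpow_two]
  rw [Real.mul_rpow (x := θ ^ 2 * r ^ 5) (y := c) (by positivity) hc,
    Real.mul_rpow (x := θ ^ 2) (y := r ^ 5) (by positivity) (by positivity), h1, h2,
    Real.mul_rpow (x := k) (y := r ^ (5 / 3 : ℝ)) hk (by positivity), h3]
  calc θ ^ (1 / 5 : ℝ) * r ^ (1 / 2 : ℝ) * c ^ (1 / 10 : ℝ) * (k ^ (9 / 10 : ℝ) * r ^ (3 / 2 : ℝ))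
      = c ^ (1 / 10 : ℝ) * k ^ (9 / 10 : ℝ) * θ ^ (1 / 5 : ℝ) * (r ^ (1 / 2 : ℝ) * r ^ (3 / 2 : ℝ)) := by
        ring
    _ = c ^ (1 / 10 : ℝ) * k ^ (9 / 10 : ℝ) * θ ^ (1 / 5 : ℝ) * r ^ 2 := by rw [h4]

/-- `(k r²)^{2/3} (c θ^{1/5} r²)^{1/3} = k^{2/3} c^{1/3} θ^{1/15} r²`. [folklore] -/
theorem rpow_bookkeeping_mpu {θ r c k : ℝ} (hθ : 0 ≤ θ) (hc : 0 ≤ c) (hk : 0 ≤ k) :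
    (k * r ^ 2) ^ (2 / 3 : ℝ) * (c * θ ^ (1 / 5 : ℝ) * r ^ 2) ^ (1 / 3 : ℝ) =
      k ^ (2 / 3 : ℝ) * c ^ (1 / 3 : ℝ) * θ ^ (1 / 15 : ℝ) * r ^ 2 := by
  have hr2 : 0 ≤ r ^ 2 := sq_nonneg r
  have h1 : (θ ^ (1 / 5 : ℝ)) ^ (1 / 3 : ℝ) = θ ^ (1 / 15 : ℝ) := by
    rw [← Real.rpow_mul hθ]; norm_num
  have h2 : (r ^ 2 : ℝ) ^ (2 / 3 : ℝ) * (r ^ 2) ^ (1 / 3 : ℝ) = r ^ 2 := by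
    rw [← Real.rpow_add' hr2 (by norm_num)]; norm_num
  rw [Real.mul_rpow (x := k) (y := r ^ 2) hk hr2,
    Real.mul_rpow (x := c * θ ^ (1 / 5 : ℝ)) (y := r ^ 2) (by positivity) hr2,
    Real.mul_rpow (x := c) (y := θ ^ (1 / 5 : ℝ)) hc (Real.rpow_nonneg hθ _), h1]
  calc k ^ (2 / 3 : ℝ) * (r ^ 2) ^ (2 / 3 : ℝ) *
        (c ^ (1 / 3 : ℝ) * θ ^ (1 / 15 : ℝ) * (r ^ 2) ^ (1 / 3 : ℝ))
      = k ^ (2 / 3 : ℝ) * c ^ (1 / 3 : ℝ) * θ ^ (1 / 15 : ℝ) *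
          ((r ^ 2) ^ (2 / 3 : ℝ) * (r ^ 2) ^ (1 / 3 : ℝ)) := by ring
    _ = k ^ (2 / 3 : ℝ) * c ^ (1 / 3 : ℝ) * θ ^ (1 / 15 : ℝ) * r ^ 2 := by rw [h2]

/-- `(s¹⁵)^{1/5} = s³` and `(s¹⁵)^{1/15} = s` for `s ≥ 0`. [folklore] -/
theorem rpow_pow_fifteen {s : ℝ} (hs : 0 ≤ s) :
    (s ^ 15 : ℝ) ^ (1 / 5 : ℝ) = s ^ 3 ∧ (s ^ 15 : ℝ) ^ (1 / 15 : ℝ) = s := by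
  refine ⟨?_, ?_⟩
  · rw [← Real.rpow_natCast s 15, ← Real.rpow_mul hs, ← Real.rpow_natCast s 3]
    norm_num
  · rw [← Real.rpow_natCast s 15, ← Real.rpow_mul hs]
    norm_num

/-! ### Real integrals on a window from the `ℝ≥0∞`-valued vertex bounds -/

/-- `∫ ‖U‖^q dμ ≤ B.toReal` whenever `∫⁻ ‖U‖ₑ^q dμ ≤ B < ∞` (`q ≥ 0`). [folklore] -/
theorem integral_norm_rpow_le_toReal {α : Type*} [MeasurableSpace α] {μ : Measure α}
    {F : Type*} [NormedAddCommGroup F] {U : α → F} (hU : AEStronglyMeasurable U μ)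
    {q : ℝ} (hq : 0 ≤ q) {B : ℝ≥0∞} (hB : B ≠ ⊤) (hle : ∫⁻ x, ‖U x‖ₑ ^ q ∂μ ≤ B) :
    ∫ x, ‖U x‖ ^ q ∂μ ≤ B.toReal := by
  rw [integral_eq_lintegral_of_nonneg_ae
    (Eventually.of_forall fun x => Real.rpow_nonneg (norm_nonneg _) _)
    (hU.norm.aemeasurable.pow_const q).aestronglyMeasurable]
  refine ENNReal.toReal_mono hB (le_trans (le_of_eq (lintegral_congr_ae ?_)) hle)
  filter_upwards with x
  rw [← ofReal_norm, ENNReal.ofReal_rpow_of_nonneg (norm_nonneg _) hq]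

/-- The gauged pressure `q = p − (p(t, 0) − p̃[u(t)](0))` of a classical Leray–Hopf solution
on `[0, T)` is a.e.-strongly measurable on every window `(t₀, t₁) × B(x₀, R)`, `0 ≤ t₀`,
`t₁ < T`. [folklore] -/
theorem aestronglyMeasurable_gauge_window {T : ℝ} (hT : 0 < T)
    {u : ℝ → EuclideanSpace ℝ (Fin 3) → EuclideanSpace ℝ (Fin 3)}
    {p : ℝ → EuclideanSpace ℝ (Fin 3) → ℝ}
    (hsol : IsClassicalNSSolutionOn (Ico 0 T) 1 0 u p) (hLH : IsLerayHopfOn T 1 0 (u 0) u)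
    {t₀ t₁ : ℝ} (ht₀ : 0 ≤ t₀) (ht₁ : t₁ < T) (x₀ : EuclideanSpace ℝ (Fin 3)) (R : ℝ) :
    AEStronglyMeasurable
      (fun z : ℝ × EuclideanSpace ℝ (Fin 3) =>
        p z.1 z.2 - (p z.1 0 - normalisedPressure (u z.1) 0))
      (volume.restrict (Ioo t₀ t₁ ×ˢ ball x₀ R)) := by
  obtain ⟨-, hloc⟩ := exists_pressure_gauge_of_classical one_pos hT hsol hLH
  obtain ⟨C, M, hCm, hCb, hae⟩ := hloc t₁ ht₁
  set K : Set (ℝ × EuclideanSpace ℝ (Fin 3)) := Icc t₀ t₁ ×ˢ closedBall x₀ R with hKdef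
  have hK : IsCompact K := isCompact_Icc.prod (isCompact_closedBall x₀ R)
  have hKsub : K ⊆ Icc 0 t₁ ×ˢ (univ : Set (EuclideanSpace ℝ (Fin 3))) :=
    prod_mono (Icc_subset_Icc_left ht₀) (subset_univ _)
  have hc : IntegrableOn
      (fun z : ℝ × EuclideanSpace ℝ (Fin 3) => p z.1 0 - normalisedPressure (u z.1) 0) K volume :=
    (integrableOn_and_lintegral_lt_top_of_ae_eq hCm hCb hae hK hKsub).1
  have hKS : K ⊆ Ico 0 T ×ˢ (univ : Set (EuclideanSpace ℝ (Fin 3))) :=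
    prod_mono (fun t ht => ⟨ht₀.trans ht.1, lt_of_le_of_lt ht.2 ht₁⟩) (subset_univ _)
  have hp : ContinuousOn (fun z : ℝ × EuclideanSpace ℝ (Fin 3) => p z.1 z.2) K :=
    hsol.smooth_pressure.continuousOn.mono hKS
  have hWK : Ioo t₀ t₁ ×ˢ ball x₀ R ⊆ K := prod_mono Ioo_subset_Icc_self ball_subset_closedBall
  have h1 : AEStronglyMeasurable (fun z : ℝ × EuclideanSpace ℝ (Fin 3) => p z.1 z.2)
      (volume.restrict K) :=
    hp.aestronglyMeasurable hK.measurableSet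
  exact (h1.sub hc.integrable.aestronglyMeasurable).mono_measure (Measure.restrict_mono hWK le_rfl)

/-! ### The window quantities of a classical solution -/

/-- **The three window quantities, measure-theoretically.** For a classical Leray–Hopf solution on
`[0, T)` and a window `W = (t₀, t₁) × B(x₀, R)` with `0 < t₀ ≤ t₁ < T`: if
`∬_W |u|^{10/3} ≤ B₁₀ < ∞` and `∬_W |q|^{3/2} ≤ B₃₂ < ∞` (as `ℝ≥0∞`-integrals, `q` the gauged
pressure), then `∬_W |u|³ ≤ |W|^{1/10} B₁₀^{9/10}`, `|q| |u|` is integrable on `W`, and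
`∬_W |q| |u| ≤ B₃₂^{2/3} (∬_W |u|³)^{1/3}` (Hölder, `SereginSverakWindowHolder.lean`; `u` is
continuous, hence bounded, on the compact closure of the window). [folklore] -/
theorem window_integral_bounds {T : ℝ} (hT : 0 < T)
    {u : ℝ → EuclideanSpace ℝ (Fin 3) → EuclideanSpace ℝ (Fin 3)}
    {p : ℝ → EuclideanSpace ℝ (Fin 3) → ℝ}
    (hsol : IsClassicalNSSolutionOn (Ico 0 T) 1 0 u p) (hLH : IsLerayHopfOn T 1 0 (u 0) u)
    {t₀ t₁ : ℝ} (ht₀ : 0 < t₀) (ht₁ : t₁ < T) (x₀ : EuclideanSpace ℝ (Fin 3))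
    (R : ℝ) {B₁₀ B₃₂ : ℝ≥0∞} (hB₁₀ : B₁₀ ≠ ⊤) (hB₃₂ : B₃₂ ≠ ⊤)
    (h10 : ∫⁻ z in Ioo t₀ t₁ ×ˢ ball x₀ R, ‖u z.1 z.2‖ₑ ^ (10 / 3 : ℝ) ≤ B₁₀)
    (h32 : ∫⁻ z in Ioo t₀ t₁ ×ˢ ball x₀ R,
      ‖p z.1 z.2 - (p z.1 0 - normalisedPressure (u z.1) 0)‖ₑ ^ (3 / 2 : ℝ) ≤ B₃₂) :
    (∫ z in Ioo t₀ t₁ ×ˢ ball x₀ R, ‖u z.1 z.2‖ ^ 3 ≤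
        (volume.real (Ioo t₀ t₁ ×ˢ ball x₀ R)) ^ (1 / 10 : ℝ) * B₁₀.toReal ^ (9 / 10 : ℝ)) ∧
    IntegrableOn (fun z : ℝ × EuclideanSpace ℝ (Fin 3) =>
        |p z.1 z.2 - (p z.1 0 - normalisedPressure (u z.1) 0)| * ‖u z.1 z.2‖)
      (Ioo t₀ t₁ ×ˢ ball x₀ R) ∧
    (∫ z in Ioo t₀ t₁ ×ˢ ball x₀ R,
        |p z.1 z.2 - (p z.1 0 - normalisedPressure (u z.1) 0)| * ‖u z.1 z.2‖ ≤
      B₃₂.toReal ^ (2 / 3 : ℝ) *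
        (∫ z in Ioo t₀ t₁ ×ˢ ball x₀ R, ‖u z.1 z.2‖ ^ 3) ^ (1 / 3 : ℝ)) := by
  set W : Set (ℝ × EuclideanSpace ℝ (Fin 3)) := Ioo t₀ t₁ ×ˢ ball x₀ R with hW
  set qf : ℝ × EuclideanSpace ℝ (Fin 3) → ℝ :=
    fun z => p z.1 z.2 - (p z.1 0 - normalisedPressure (u z.1) 0) with hqf
  have hIoo : Icc t₀ t₁ ⊆ Ioo 0 T := fun s hs => ⟨ht₀.trans_le hs.1, hs.2.trans_lt ht₁⟩
  -- compactness: `u` is bounded and measurable on the window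
  have hKcpt : IsCompact (Icc t₀ t₁ ×ˢ closedBall x₀ R) :=
    isCompact_Icc.prod (isCompact_closedBall _ _)
  have hWK : W ⊆ Icc t₀ t₁ ×ˢ closedBall x₀ R := prod_mono Ioo_subset_Icc_self ball_subset_closedBall
  have hKS : Icc t₀ t₁ ×ˢ closedBall x₀ R ⊆ Ico 0 T ×ˢ (univ : Set (EuclideanSpace ℝ (Fin 3))) :=
    prod_mono (fun s hs => ⟨(hIoo hs).1.le, (hIoo hs).2⟩) (subset_univ _)
  have hUc : ContinuousOn (fun z : ℝ × EuclideanSpace ℝ (Fin 3) => u z.1 z.2)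
      (Icc t₀ t₁ ×ˢ closedBall x₀ R) :=
    hsol.smooth_velocity.continuousOn.mono hKS
  obtain ⟨B, hB⟩ := hKcpt.exists_bound_of_continuousOn hUc
  have hUm : AEStronglyMeasurable (fun z : ℝ × EuclideanSpace ℝ (Fin 3) => u z.1 z.2)
      (volume.restrict W) :=
    (hUc.aestronglyMeasurable hKcpt.measurableSet).mono_measure (Measure.restrict_mono hWK le_rfl)
  have hUB : ∀ᵐ z ∂(volume.restrict W), ‖u z.1 z.2‖ ≤ B :=
    (ae_restrict_iff' (measurableSet_Ioo.prod measurableSet_ball)).2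
      (Eventually.of_forall fun z hz => hB z (hWK hz))
  have hWfin : volume W < ⊤ := (hKcpt.measure_lt_top).trans_le' (measure_mono hWK)
  haveI : IsFiniteMeasure (volume.restrict W) := ⟨by rw [Measure.restrict_apply_univ]; exact hWfin⟩
  -- (i) `∬ |u|³ ≤ |W|^{1/10} B₁₀^{9/10}`
  have hI10 : ∫ z in W, ‖u z.1 z.2‖ ^ (10 / 3 : ℝ) ≤ B₁₀.toReal :=
    integral_norm_rpow_le_toReal hUm (by norm_num) hB₁₀ h10
  have hI0 : 0 ≤ ∫ z in W, ‖u z.1 z.2‖ ^ (10 / 3 : ℝ) :=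
    integral_nonneg fun z => Real.rpow_nonneg (norm_nonneg _) _
  have h3 : ∫ z in W, ‖u z.1 z.2‖ ^ 3 ≤ (volume.real W) ^ (1 / 10 : ℝ) * B₁₀.toReal ^ (9 / 10 : ℝ) := by
    have hH := integral_norm_pow_three_le_rpow (μ := volume.restrict W) hUm hUB
    have hμ : (volume.restrict W).real univ = volume.real W := by
      rw [measureReal_def, measureReal_def, Measure.restrict_apply_univ]
    rw [hμ] at hH
    exact hH.trans (mul_le_mul_of_nonneg_left (Real.rpow_le_rpow hI0 hI10 (by norm_num))
      (Real.rpow_nonneg measureReal_nonneg _))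
  -- (ii), (iii) the pressure–velocity product
  have hqm : AEStronglyMeasurable qf (volume.restrict W) :=
    aestronglyMeasurable_gauge_window hT hsol hLH ht₀.le ht₁ x₀ R
  have hqMem : MemLp qf (ENNReal.ofReal (3 / 2)) (volume.restrict W) := by
    refine ⟨hqm, ?_⟩
    rw [eLpNorm_lt_top_iff_lintegral_rpow_enorm_lt_top (ENNReal.ofReal_pos.2 (by norm_num)).ne'
      ENNReal.ofReal_ne_top, ENNReal.toReal_ofReal (by norm_num)]
    exact h32.trans_lt (lt_top_iff_ne_top.2 hB₃₂)
  have hUMem : MemLp (fun z : ℝ × EuclideanSpace ℝ (Fin 3) => u z.1 z.2) (ENNReal.ofReal 3)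
      (volume.restrict W) :=
    MemLp.of_bound hUm B hUB
  have hI32 : ∫ z in W, |qf z| ^ (3 / 2 : ℝ) ≤ B₃₂.toReal := by
    have := integral_norm_rpow_le_toReal hqm (by norm_num : (0 : ℝ) ≤ 3 / 2) hB₃₂ h32
    simpa only [Real.norm_eq_abs] using this
  have hqu : IntegrableOn (fun z : ℝ × EuclideanSpace ℝ (Fin 3) => |qf z| * ‖u z.1 z.2‖) W := by
    have hq1 : Integrable qf (volume.restrict W) :=
      MemLp.integrable (by rw [← ENNReal.ofReal_one]; exact ENNReal.ofReal_le_ofReal (by norm_num))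
        hqMem
    refine Integrable.mono' (hq1.norm.mul_const B) (hqm.norm.mul hUm.norm) ?_
    filter_upwards [hUB] with z hz
    rw [Real.norm_eq_abs, abs_mul, abs_abs, abs_norm, Real.norm_eq_abs]
    exact mul_le_mul_of_nonneg_left hz (abs_nonneg _)
  have hpu : ∫ z in W, |qf z| * ‖u z.1 z.2‖ ≤
      B₃₂.toReal ^ (2 / 3 : ℝ) * (∫ z in W, ‖u z.1 z.2‖ ^ 3) ^ (1 / 3 : ℝ) := by
    have hH := integral_abs_mul_norm_le_rpow hqMem hUMem
    have hJ0 : 0 ≤ ∫ z in W, |qf z| ^ (3 / 2 : ℝ) :=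
      integral_nonneg fun z => Real.rpow_nonneg (abs_nonneg _) _
    have hm0 : 0 ≤ ∫ z in W, ‖u z.1 z.2‖ ^ 3 := integral_nonneg fun z => by positivity
    exact hH.trans (mul_le_mul_of_nonneg_right (Real.rpow_le_rpow hJ0 hI32 (by norm_num))
      (Real.rpow_nonneg hm0 _))
  exact ⟨h3, hqu, hpu⟩

/-! ### The jump of the probe energy over a short final window -/

/-- **The window jump, in scale-invariant form.** For a probe pair with `P̄ > 0` and `L ≥ 1` there
is `C = C(P̄, L) ≥ 0` such that, for every classical Leray–Hopf solution on `[0, T)` (`ν = 1`)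
with a one-sided pressure bound (`K ≥ 0`), every centre `x₀` with vertex bounds
`∬_{Q_ρ(T,x₀)} |u|^{10/3} ≤ K₁ ρ^{5/3}`, `∬_{Q_ρ(T,x₀)} |q|^{3/2} ≤ K₁ ρ²` (`ρ ≤ ρ₀/2`), every scale
`r` with `3Lr ≤ 1/2`, `4Lr ≤ ρ₀/2`, every `0 < θ ≤ 1` and every window
`T − θ²r² < t₀ ≤ t₁ < T`, `t₁ − t₀ ≤ θ²r²`, `t₀ > 0`:
`F(r; t₁) − F(r; t₀) ≤ L⁻² M_F + 6 C L M_F θ² + C c₃ θ^{1/5} + 2 C c₄ θ^{1/15}`, where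
`M_F = ‖u(0)‖₂² + 4πK`, `c₃ = (27 L³ |B₁|)^{1/10} (K₁ (4L)^{5/3})^{9/10}`,
`c₄ = (16 L² K₁)^{2/3} c₃^{1/3}`. [cite: SereginSverak2002, §3–4; reconstruction] -/
theorem probeEnergy_window_jump_le (hP : ContDiff ℝ ∞ P) (hPb : ContDiff ℝ ∞ Pb)
    (hode : ∀ σ, Pb σ + 2 / 3 * σ * deriv Pb σ = P σ) (hP0 : ∀ σ, 1 ≤ σ → P σ = 0)
    (hPnn : ∀ σ, 0 ≤ P σ) (hPle : ∀ σ, P σ ≤ Pb σ) (hPble : ∀ σ, Pb σ ≤ 1)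
    (hPbpos : ∀ σ, 0 < Pb σ) (hPb1 : ∀ σ, σ ≤ 1 / 4 → Pb σ = 1) (hPb' : ∀ σ, deriv Pb σ ≤ 0)
    {L : ℝ} (hL : 1 ≤ L) :
    ∃ C : ℝ, 0 ≤ C ∧
    ∀ {T : ℝ} {u : ℝ → EuclideanSpace ℝ (Fin 3) → EuclideanSpace ℝ (Fin 3)}
      {p : ℝ → EuclideanSpace ℝ (Fin 3) → ℝ},
      0 < T → IsClassicalNSSolutionOn (Ico 0 T) 1 0 u p → IsLerayHopfOn T 1 0 (u 0) u →
    ∀ {K : ℝ}, 0 ≤ K →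
      ((∀ t ∈ Ioo 0 T, ∀ x, ‖u t x‖ ^ 2 / 2 + normalisedPressure (u t) x ≤ K) ∨
        (∀ t ∈ Ioo 0 T, ∀ x, -K ≤ normalisedPressure (u t) x)) →
    ∀ (x₀ : EuclideanSpace ℝ (Fin 3)) {ρ₀ : ℝ} {K₁ : ℝ≥0},
      (∀ ρ ∈ Ioc 0 (ρ₀ / 2),
        (∫⁻ z in parabolicCylinder ρ (T, x₀), ‖u z.1 z.2‖ₑ ^ (10 / 3 : ℝ) ≤
            K₁ * ENNReal.ofReal (ρ ^ (5 / 3 : ℝ))) ∧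
        (∫⁻ z in parabolicCylinder ρ (T, x₀),
            ‖p z.1 z.2 - (p z.1 0 - normalisedPressure (u z.1) 0)‖ₑ ^ (3 / 2 : ℝ) ≤
            K₁ * ENNReal.ofReal (ρ ^ 2))) →
    ∀ {MF c₃ c₄ : ℝ}, MF = (∫ x, ‖u 0 x‖ ^ 2) + 4 * π * K →
      c₃ = (27 * L ^ 3 * volume.real (ball (0 : EuclideanSpace ℝ (Fin 3)) 1)) ^ (1 / 10 : ℝ) *
        ((K₁ : ℝ) * (4 * L) ^ (5 / 3 : ℝ)) ^ (9 / 10 : ℝ) →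
      c₄ = (16 * L ^ 2 * (K₁ : ℝ)) ^ (2 / 3 : ℝ) * c₃ ^ (1 / 3 : ℝ) →
    ∀ {r θ t₀ t₁ : ℝ}, 0 < r → 3 * L * r ≤ 1 / 2 → 4 * L * r ≤ ρ₀ / 2 → 0 < θ → θ ≤ 1 →
      0 < t₀ → T - θ ^ 2 * r ^ 2 < t₀ → t₀ ≤ t₁ → t₁ < T → t₁ - t₀ ≤ θ ^ 2 * r ^ 2 →
      (∫ x, ‖u t₁ x‖ ^ 2 * (r⁻¹ * Pb (‖x - x₀‖ ^ 2 / r ^ 2))) -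
          (∫ x, ‖u t₀ x‖ ^ 2 * (r⁻¹ * Pb (‖x - x₀‖ ^ 2 / r ^ 2))) ≤
        (L ^ 2)⁻¹ * MF +
          (6 * C * L * MF * θ ^ 2 + C * c₃ * θ ^ (1 / 5 : ℝ) + 2 * C * c₄ * θ ^ (1 / 15 : ℝ)) := by
  obtain ⟨C, hC0, hwin⟩ := probeEnergy_sub_le_window hP hPb hode hP0 hPbpos hPble hPb1 hL
  refine ⟨C, hC0, ?_⟩
  intro T u p hT hsol hLH K hK hone x₀ ρ₀ K₁ hK₁ MF c₃ c₄ hMF hc₃ hc₄ r θ t₀ t₁ hr h3Lr h4Lr hθ hθ1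
    ht₀ ht₀w ht₀₁ ht₁ hlen
  have hL0 : 0 < L := by linarith
  have hMFnn : 0 ≤ MF := by
    rw [hMF]; exact add_nonneg (integral_nonneg fun x => by positivity) (by positivity)
  have hb₁ : 0 ≤ volume.real (ball (0 : EuclideanSpace ℝ (Fin 3)) 1) := measureReal_nonneg
  have hc₃nn : 0 ≤ c₃ := by
    rw [hc₃]
    exact mul_nonneg (Real.rpow_nonneg (mul_nonneg (by positivity) hb₁) _)
      (Real.rpow_nonneg (by positivity) _)
  have hIoo : Icc t₀ t₁ ⊆ Ioo 0 T := fun s hs => ⟨ht₀.trans_le hs.1, hs.2.trans_lt ht₁⟩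
  have hsol' : IsClassicalNSSolutionOn (Ioo 0 T) 1 0 u p :=
    hsol.mono Ioo_subset_Ico_self (uniqueDiffOn_Ioo 0 T)
  have hfin : ∀ s ∈ Icc t₀ t₁, Integrable fun y => ‖u s y‖ ^ 2 := fun s hs =>
    (hLH.memLp s ⟨(hIoo hs).1.le, (hIoo hs).2.le⟩).integrable_norm_pow two_ne_zero
  -- Type I bound on the ball energies: `a = 2 M_F · 3Lr`
  have ha : ∀ s ∈ Icc t₀ t₁, ∫ x in ball x₀ (3 * L * r), ‖u s x‖ ^ 2 ≤
      2 * MF * (3 * L * r) := fun s hs => by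
    rw [hMF]
    exact setIntegral_ball_norm_sq_le_uniform zero_le_one hsol hLH hK hone (hIoo hs) x₀
      (by positivity) h3Lr
  -- the window inside `Q_{4Lr}(T, x₀)` and the vertex bounds there
  have hθ41 : θ ^ 2 ≤ (4 * L) ^ 2 := by
    have h1 : θ ^ 2 ≤ 1 := pow_le_one₀ hθ.le hθ1
    nlinarith
  have hWQ : Ioo t₀ t₁ ×ˢ ball x₀ (3 * L * r) ⊆ parabolicCylinder (4 * L * r) (T, x₀) := by
    refine window_subset_parabolicCylinder x₀ ?_ ht₁.le (by nlinarith)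
    have : θ ^ 2 * r ^ 2 ≤ (4 * L * r) ^ 2 := by
      rw [mul_pow]; exact mul_le_mul_of_nonneg_right hθ41 (sq_nonneg _)
    linarith
  have h4Lr0 : 0 < 4 * L * r := by positivity
  obtain ⟨h10, h32⟩ := hK₁ (4 * L * r) ⟨h4Lr0, h4Lr⟩
  have hB10 : (K₁ : ℝ≥0∞) * ENNReal.ofReal ((4 * L * r) ^ (5 / 3 : ℝ)) ≠ ⊤ :=
    ENNReal.mul_ne_top ENNReal.coe_ne_top ENNReal.ofReal_ne_top
  have hB32 : (K₁ : ℝ≥0∞) * ENNReal.ofReal ((4 * L * r) ^ 2) ≠ ⊤ :=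
    ENNReal.mul_ne_top ENNReal.coe_ne_top ENNReal.ofReal_ne_top
  obtain ⟨hm3, hqu, hpu⟩ := window_integral_bounds hT hsol hLH ht₀ ht₁ x₀ (3 * L * r)
    hB10 hB32 ((lintegral_mono_set hWQ).trans h10) ((lintegral_mono_set hWQ).trans h32)
  have e10 : ((K₁ : ℝ≥0∞) * ENNReal.ofReal ((4 * L * r) ^ (5 / 3 : ℝ))).toReal =
      (K₁ : ℝ) * (4 * L * r) ^ (5 / 3 : ℝ) := by
    rw [ENNReal.toReal_mul, ENNReal.coe_toReal, ENNReal.toReal_ofReal (by positivity)]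
  have e32 : ((K₁ : ℝ≥0∞) * ENNReal.ofReal ((4 * L * r) ^ 2)).toReal = (K₁ : ℝ) * (4 * L * r) ^ 2 := by
    rw [ENNReal.toReal_mul, ENNReal.coe_toReal, ENNReal.toReal_ofReal (by positivity)]
  rw [e10] at hm3
  rw [e32] at hpu
  -- the measure of the window
  have hvol : volume.real (Ioo t₀ t₁ ×ˢ ball x₀ (3 * L * r)) ≤
      θ ^ 2 * r ^ 5 * (27 * L ^ 3 * volume.real (ball (0 : EuclideanSpace ℝ (Fin 3)) 1)) := by
    rw [volume_real_window ht₀₁ (by positivity) x₀]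
    calc (t₁ - t₀) * ((3 * L * r) ^ 3 * volume.real (ball (0 : EuclideanSpace ℝ (Fin 3)) 1))
        ≤ θ ^ 2 * r ^ 2 * ((3 * L * r) ^ 3 * volume.real (ball (0 : EuclideanSpace ℝ (Fin 3)) 1)) :=
          mul_le_mul_of_nonneg_right hlen (mul_nonneg (by positivity) hb₁)
      _ = θ ^ 2 * r ^ 5 * (27 * L ^ 3 * volume.real (ball (0 : EuclideanSpace ℝ (Fin 3)) 1)) := by
          ring
  -- `m₃ ≤ c₃ θ^{1/5} r²`
  have hm3' : ∫ z in Ioo t₀ t₁ ×ˢ ball x₀ (3 * L * r), ‖u z.1 z.2‖ ^ 3 ≤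
      c₃ * θ ^ (1 / 5 : ℝ) * r ^ 2 := by
    have hk0 : 0 ≤ (K₁ : ℝ) * (4 * L * r) ^ (5 / 3 : ℝ) := by positivity
    calc ∫ z in Ioo t₀ t₁ ×ˢ ball x₀ (3 * L * r), ‖u z.1 z.2‖ ^ 3
        ≤ (volume.real (Ioo t₀ t₁ ×ˢ ball x₀ (3 * L * r))) ^ (1 / 10 : ℝ) *
            ((K₁ : ℝ) * (4 * L * r) ^ (5 / 3 : ℝ)) ^ (9 / 10 : ℝ) := hm3
      _ ≤ (θ ^ 2 * r ^ 5 * (27 * L ^ 3 * volume.real (ball (0 : EuclideanSpace ℝ (Fin 3)) 1))) ^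
            (1 / 10 : ℝ) * ((K₁ : ℝ) * (4 * L * r) ^ (5 / 3 : ℝ)) ^ (9 / 10 : ℝ) :=
          mul_le_mul_of_nonneg_right (Real.rpow_le_rpow measureReal_nonneg hvol (by norm_num))
            (Real.rpow_nonneg hk0 _)
      _ = (θ ^ 2 * r ^ 5 * (27 * L ^ 3 * volume.real (ball (0 : EuclideanSpace ℝ (Fin 3)) 1))) ^
            (1 / 10 : ℝ) * ((K₁ : ℝ) * (4 * L) ^ (5 / 3 : ℝ) * r ^ (5 / 3 : ℝ)) ^ (9 / 10 : ℝ) := by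
          rw [Real.mul_rpow (x := 4 * L) (y := r) (by positivity) hr.le,
            ← mul_assoc (K₁ : ℝ) ((4 * L) ^ (5 / 3 : ℝ)) (r ^ (5 / 3 : ℝ))]
      _ = (27 * L ^ 3 * volume.real (ball (0 : EuclideanSpace ℝ (Fin 3)) 1)) ^ (1 / 10 : ℝ) *
            ((K₁ : ℝ) * (4 * L) ^ (5 / 3 : ℝ)) ^ (9 / 10 : ℝ) * θ ^ (1 / 5 : ℝ) * r ^ 2 :=
          rpow_bookkeeping_m₃ hθ.le hr (mul_nonneg (by positivity) hb₁) (by positivity)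
      _ = c₃ * θ ^ (1 / 5 : ℝ) * r ^ 2 := by rw [hc₃]
  -- `m_{pu} ≤ c₄ θ^{1/15} r²`
  have hpu' : ∫ z in Ioo t₀ t₁ ×ˢ ball x₀ (3 * L * r),
      |p z.1 z.2 - (p z.1 0 - normalisedPressure (u z.1) 0)| * ‖u z.1 z.2‖ ≤
      c₄ * θ ^ (1 / 15 : ℝ) * r ^ 2 := by
    have hm0 : 0 ≤ ∫ z in Ioo t₀ t₁ ×ˢ ball x₀ (3 * L * r), ‖u z.1 z.2‖ ^ 3 :=
      integral_nonneg fun z => by positivity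
    calc ∫ z in Ioo t₀ t₁ ×ˢ ball x₀ (3 * L * r),
          |p z.1 z.2 - (p z.1 0 - normalisedPressure (u z.1) 0)| * ‖u z.1 z.2‖
        ≤ ((K₁ : ℝ) * (4 * L * r) ^ 2) ^ (2 / 3 : ℝ) *
            (∫ z in Ioo t₀ t₁ ×ˢ ball x₀ (3 * L * r), ‖u z.1 z.2‖ ^ 3) ^ (1 / 3 : ℝ) := hpu
      _ ≤ ((K₁ : ℝ) * (4 * L * r) ^ 2) ^ (2 / 3 : ℝ) * (c₃ * θ ^ (1 / 5 : ℝ) * r ^ 2) ^ (1 / 3 : ℝ) :=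
          mul_le_mul_of_nonneg_left (Real.rpow_le_rpow hm0 hm3' (by norm_num))
            (Real.rpow_nonneg (by positivity) _)
      _ = (16 * L ^ 2 * (K₁ : ℝ) * r ^ 2) ^ (2 / 3 : ℝ) *
            (c₃ * θ ^ (1 / 5 : ℝ) * r ^ 2) ^ (1 / 3 : ℝ) := by
          congr 2; ring
      _ = (16 * L ^ 2 * (K₁ : ℝ)) ^ (2 / 3 : ℝ) * c₃ ^ (1 / 3 : ℝ) * θ ^ (1 / 15 : ℝ) * r ^ 2 :=
          rpow_bookkeeping_mpu hθ.le hc₃nn (by positivity)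
      _ = c₄ * θ ^ (1 / 15 : ℝ) * r ^ 2 := by rw [hc₄]
  -- name the two window integrals and apply the window bound
  obtain ⟨M3, hM3⟩ : ∃ M3 : ℝ, M3 = ∫ z in Ioo t₀ t₁ ×ˢ ball x₀ (3 * L * r), ‖u z.1 z.2‖ ^ 3 :=
    ⟨_, rfl⟩
  obtain ⟨MPU, hMPU⟩ : ∃ MPU : ℝ, MPU = ∫ z in Ioo t₀ t₁ ×ˢ ball x₀ (3 * L * r),
      |p z.1 z.2 - (p z.1 0 - normalisedPressure (u z.1) 0)| * ‖u z.1 z.2‖ := ⟨_, rfl⟩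
  rw [← hM3] at hm3'
  rw [← hMPU] at hpu'
  have hkey := hwin hsol' isOpen_Ioo zero_le_one x₀ hr ht₀₁ hIoo hfin ha
    (c := fun t => p t 0 - normalisedPressure (u t) 0) (m₃ := M3) (mpu := MPU)
    (le_of_eq hM3.symm) hqu (le_of_eq hMPU.symm)
  -- the four terms
  have hterm₁ : (L ^ 2)⁻¹ * ∫ x, ‖u t₁ x‖ ^ 2 * ((L * r)⁻¹ * Pb (‖x - x₀‖ ^ 2 / (L * r) ^ 2)) ≤
      (L ^ 2)⁻¹ * MF := by
    refine mul_le_mul_of_nonneg_left ?_ (by positivity)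
    rw [hMF]
    exact probeEnergy_le_uniform hP hPb hode hP0 hPnn hPle hPble hPb' zero_le_one hsol hLH hK hone
      (hIoo (right_mem_Icc.2 ht₀₁)) x₀ (mul_pos hL0 hr) (by nlinarith)
  have hterm₂ : 1 * (C / r ^ 3) * (2 * MF * (3 * L * r)) * (t₁ - t₀) ≤ 6 * C * L * MF * θ ^ 2 := by
    have h1 : 1 * (C / r ^ 3) * (2 * MF * (3 * L * r)) * (t₁ - t₀) ≤
        1 * (C / r ^ 3) * (2 * MF * (3 * L * r)) * (θ ^ 2 * r ^ 2) :=
      mul_le_mul_of_nonneg_left hlen (by positivity)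
    have h2 : 1 * (C / r ^ 3) * (2 * MF * (3 * L * r)) * (θ ^ 2 * r ^ 2) =
        6 * C * L * MF * θ ^ 2 := by
      field_simp; ring
    linarith
  have hterm₃ : C / r ^ 2 * M3 ≤ C * c₃ * θ ^ (1 / 5 : ℝ) := by
    calc C / r ^ 2 * M3 ≤ C / r ^ 2 * (c₃ * θ ^ (1 / 5 : ℝ) * r ^ 2) :=
          mul_le_mul_of_nonneg_left hm3' (by positivity)
      _ = C * c₃ * θ ^ (1 / 5 : ℝ) := by field_simp
  have hterm₄ : 2 * (C / r ^ 2) * MPU ≤ 2 * C * c₄ * θ ^ (1 / 15 : ℝ) := by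
    calc 2 * (C / r ^ 2) * MPU ≤ 2 * (C / r ^ 2) * (c₄ * θ ^ (1 / 15 : ℝ) * r ^ 2) :=
          mul_le_mul_of_nonneg_left hpu' (by positivity)
      _ = 2 * C * c₄ * θ ^ (1 / 15 : ℝ) := by field_simp
  linarith [hkey, hterm₁, hterm₂, hterm₃, hterm₄]

/-! ### The theorem -/

/-- **Largeness of the probe energy on final parabolic windows at a singular point.** For a probe
pair `(P, P̄)` (with `P̄ > 0`) let `δ > 0` be the constant of
`frequently_probeEnergy_gt_of_not_isBackwardBoundedAt`. For every classical solution of the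
Navier–Stokes system on `[0, T) × ℝ³` (`ν = 1`), Leray–Hopf on `[0, T]`, with
`|u|²/2 + p̃ ≤ K` or `p̃ ≥ −K` (`K ≥ 0`), and every `x₀` with `¬ IsBackwardBoundedAt u T x₀`,
there are `θ > 0` and `r₀ > 0` with `θ² r₀² < T` such that
`δ/2 ≤ ∫ |u(t)|² r⁻¹ P̄(|x − x₀|²/r²)` for all `0 < r ≤ r₀` and all `t ∈ (T − θ²r², T)`.
[cite: SereginSverak2002, §3–4 (main theorem, blow-up step); reconstruction] -/
theorem probeEnergy_ge_on_final_windows (hP : ContDiff ℝ ∞ P) (hPb : ContDiff ℝ ∞ Pb)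
    (hode : ∀ σ, Pb σ + 2 / 3 * σ * deriv Pb σ = P σ) (hP0 : ∀ σ, 1 ≤ σ → P σ = 0)
    (hPnn : ∀ σ, 0 ≤ P σ) (hPle : ∀ σ, P σ ≤ Pb σ) (hPble : ∀ σ, Pb σ ≤ 1)
    (hPbpos : ∀ σ, 0 < Pb σ) (hPb1 : ∀ σ, σ ≤ 1 / 4 → Pb σ = 1) (hPb' : ∀ σ, deriv Pb σ ≤ 0) :
    ∃ δ : ℝ, 0 < δ ∧
    ∀ (T : ℝ) (u : ℝ → EuclideanSpace ℝ (Fin 3) → EuclideanSpace ℝ (Fin 3))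
      (p : ℝ → EuclideanSpace ℝ (Fin 3) → ℝ), 0 < T →
      IsClassicalNSSolutionOn (Ico 0 T) 1 0 u p → IsLerayHopfOn T 1 0 (u 0) u →
      ∀ (K : ℝ), 0 ≤ K →
      ((∀ t ∈ Ioo 0 T, ∀ x, ‖u t x‖ ^ 2 / 2 + normalisedPressure (u t) x ≤ K) ∨
        (∀ t ∈ Ioo 0 T, ∀ x, -K ≤ normalisedPressure (u t) x)) →
      ∀ (x₀ : EuclideanSpace ℝ (Fin 3)), ¬ IsBackwardBoundedAt u T x₀ →
        ∃ θ : ℝ, 0 < θ ∧ ∃ r₀ : ℝ, 0 < r₀ ∧ θ ^ 2 * r₀ ^ 2 < T ∧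
          ∀ r ∈ Ioc 0 r₀, ∀ t ∈ Ioo (T - θ ^ 2 * r ^ 2) T,
            δ / 2 ≤ ∫ x, ‖u t x‖ ^ 2 * (r⁻¹ * Pb (‖x - x₀‖ ^ 2 / r ^ 2)) := by
  obtain ⟨δ, hδ, hfreq⟩ := frequently_probeEnergy_gt_of_not_isBackwardBoundedAt hP hPb hode hP0
    hPnn hPle hPble hPb1 hPb'
  refine ⟨δ, hδ, ?_⟩
  intro T u p hT hsol hLH K hK hone x₀ hsing
  -- the solution-dependent bound `M_F = ‖u(0)‖₂² + 4πK`
  obtain ⟨MF, hMF⟩ : ∃ MF : ℝ, MF = (∫ x, ‖u 0 x‖ ^ 2) + 4 * π * K := ⟨_, rfl⟩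
  have hMFnn : 0 ≤ MF := by
    rw [hMF]; exact add_nonneg (integral_nonneg fun x => by positivity) (by positivity)
  -- the vertex bounds on `Q_ρ(T, x₀)`, `ρ ≤ ρ₀/2`
  obtain ⟨ρ₀, hρ₀pos, hρ₀half, hρ₀sqT⟩ : ∃ ρ₀ : ℝ, 0 < ρ₀ ∧ ρ₀ ≤ 1 / 2 ∧ ρ₀ ^ 2 ≤ T / 4 := by
    refine ⟨min (1 / 2) (Real.sqrt T / 2), lt_min (by norm_num) (by positivity), min_le_left _ _, ?_⟩
    have h0 : 0 ≤ min (1 / 2) (Real.sqrt T / 2) := le_min (by norm_num) (by positivity)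
    have h2 := pow_le_pow_left₀ h0 (min_le_right (1 / 2) (Real.sqrt T / 2)) 2
    rw [div_pow, Real.sq_sqrt hT.le] at h2
    linarith
  have hρ₀T : ρ₀ ^ 2 < T := by linarith
  obtain ⟨K₁, hK₁⟩ := exists_vertex_bounds hT hsol hLH hK hone x₀ hρ₀pos hρ₀half hρ₀T
  -- the truncation parameter `L` and the window constant `C`
  obtain ⟨L, hL1, hLtail⟩ : ∃ L : ℝ, 1 ≤ L ∧ MF ≤ δ / 8 * L ^ 2 := by
    have h8 : 0 ≤ 8 * MF / δ := by positivity
    refine ⟨8 * MF / δ + 1, by linarith, ?_⟩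
    have e : δ / 8 * (8 * MF / δ) = MF := by field_simp
    have hsq : 8 * MF / δ + 1 ≤ (8 * MF / δ + 1) ^ 2 := by nlinarith
    calc MF ≤ MF + δ / 8 := by linarith
      _ = δ / 8 * (8 * MF / δ + 1) := by rw [mul_add, e, mul_one]
      _ ≤ δ / 8 * (8 * MF / δ + 1) ^ 2 := mul_le_mul_of_nonneg_left hsq (by positivity)
  have hL0 : 0 < L := by linarith
  obtain ⟨C, hC0, hjump⟩ := probeEnergy_window_jump_le hP hPb hode hP0 hPnn hPle hPble hPbpos hPb1
    hPb' hL1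
  -- the constants of the window bound
  obtain ⟨c₃, hc₃⟩ : ∃ c₃ : ℝ,
      c₃ = (27 * L ^ 3 * volume.real (ball (0 : EuclideanSpace ℝ (Fin 3)) 1)) ^ (1 / 10 : ℝ) *
        ((K₁ : ℝ) * (4 * L) ^ (5 / 3 : ℝ)) ^ (9 / 10 : ℝ) := ⟨_, rfl⟩
  have hc₃nn : 0 ≤ c₃ := by
    have hb₁ : 0 ≤ volume.real (ball (0 : EuclideanSpace ℝ (Fin 3)) 1) := measureReal_nonneg
    rw [hc₃]
    exact mul_nonneg (Real.rpow_nonneg (mul_nonneg (by positivity) hb₁) _)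
      (Real.rpow_nonneg (by positivity) _)
  obtain ⟨c₄, hc₄⟩ : ∃ c₄ : ℝ, c₄ = (16 * L ^ 2 * (K₁ : ℝ)) ^ (2 / 3 : ℝ) * c₃ ^ (1 / 3 : ℝ) :=
    ⟨_, rfl⟩
  have hc₄nn : 0 ≤ c₄ := by rw [hc₄]; positivity
  obtain ⟨A₁, hA₁⟩ : ∃ A₁ : ℝ, A₁ = 6 * C * L * MF := ⟨_, rfl⟩
  obtain ⟨A₂, hA₂⟩ : ∃ A₂ : ℝ, A₂ = C * c₃ := ⟨_, rfl⟩
  obtain ⟨A₃, hA₃⟩ : ∃ A₃ : ℝ, A₃ = 2 * C * c₄ := ⟨_, rfl⟩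
  have hA₁nn : 0 ≤ A₁ := by rw [hA₁]; positivity
  have hA₂nn : 0 ≤ A₂ := by rw [hA₂]; positivity
  have hA₃nn : 0 ≤ A₃ := by rw [hA₃]; positivity
  -- the choice of `θ = s¹⁵`
  obtain ⟨s, hspos, hs1, hsA⟩ : ∃ s : ℝ, 0 < s ∧ s ≤ 1 ∧ (A₁ + A₂ + A₃ + 1) * s ≤ δ / 8 := by
    have hS : 0 < A₁ + A₂ + A₃ + 1 := by positivity
    refine ⟨min 1 (δ / (8 * (A₁ + A₂ + A₃ + 1))), lt_min one_pos (by positivity),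
      min_le_left _ _, ?_⟩
    calc (A₁ + A₂ + A₃ + 1) * min 1 (δ / (8 * (A₁ + A₂ + A₃ + 1)))
        ≤ (A₁ + A₂ + A₃ + 1) * (δ / (8 * (A₁ + A₂ + A₃ + 1))) :=
          mul_le_mul_of_nonneg_left (min_le_right _ _) hS.le
      _ = δ / 8 := by field_simp
  obtain ⟨θ, hθ⟩ : ∃ θ : ℝ, θ = s ^ 15 := ⟨_, rfl⟩
  have hθpos : 0 < θ := by rw [hθ]; exact pow_pos hspos 15
  have hθ1 : θ ≤ 1 := by rw [hθ]; exact pow_le_one₀ hspos.le hs1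
  have hθ2 : θ ^ 2 ≤ s := by
    rw [hθ, ← pow_mul]; exact pow_le_of_le_one hspos.le hs1 (by norm_num)
  obtain ⟨hθ5, hθ15⟩ := rpow_pow_fifteen hspos.le
  have hθ5' : θ ^ (1 / 5 : ℝ) ≤ s := by
    rw [hθ, hθ5]; exact pow_le_of_le_one hspos.le hs1 (by norm_num)
  have hθ15' : θ ^ (1 / 15 : ℝ) ≤ s := by rw [hθ, hθ15]
  have hsmall : A₁ * θ ^ 2 + A₂ * θ ^ (1 / 5 : ℝ) + A₃ * θ ^ (1 / 15 : ℝ) ≤ δ / 8 := by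
    have h1 : A₁ * θ ^ 2 ≤ A₁ * s := mul_le_mul_of_nonneg_left hθ2 hA₁nn
    have h2 : A₂ * θ ^ (1 / 5 : ℝ) ≤ A₂ * s := mul_le_mul_of_nonneg_left hθ5' hA₂nn
    have h3 : A₃ * θ ^ (1 / 15 : ℝ) ≤ A₃ * s := mul_le_mul_of_nonneg_left hθ15' hA₃nn
    linarith [hsA, h1, h2, h3, hspos,
      show (A₁ + A₂ + A₃ + 1) * s = A₁ * s + A₂ * s + A₃ * s + s by ring]
  -- the admissible scales
  obtain ⟨r₁, hr₁pos, hr₁K⟩ : ∃ r₁ : ℝ, 0 < r₁ ∧ K * r₁ ^ 2 ≤ δ := by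
    refine ⟨Real.sqrt (δ / (K + 1)), by positivity, ?_⟩
    rw [Real.sq_sqrt (by positivity)]
    calc K * (δ / (K + 1)) ≤ (K + 1) * (δ / (K + 1)) :=
          mul_le_mul_of_nonneg_right (by linarith) (by positivity)
      _ = δ := mul_div_cancel₀ _ (by positivity)
  obtain ⟨r₀, hr₀pos, hr₀ρ, hr₀L, hr₀r₁⟩ : ∃ r₀ : ℝ, 0 < r₀ ∧ r₀ ≤ ρ₀ / (8 * L) ∧
      r₀ ≤ 1 / (6 * L) ∧ r₀ ≤ r₁ :=
    ⟨min (ρ₀ / (8 * L)) (min (1 / (6 * L)) r₁),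
      lt_min (by positivity) (lt_min (by positivity) hr₁pos), min_le_left _ _,
      (min_le_right _ _).trans (min_le_left _ _), (min_le_right _ _).trans (min_le_right _ _)⟩
  have hr₀K : K * r₀ ^ 2 ≤ δ :=
    (mul_le_mul_of_nonneg_left (pow_le_pow_left₀ hr₀pos.le hr₀r₁ 2) hK).trans hr₁K
  have hr₀T : r₀ ^ 2 ≤ T / 4 := by
    have h1 : r₀ ≤ ρ₀ := by
      calc r₀ ≤ ρ₀ / (8 * L) := hr₀ρ
        _ ≤ ρ₀ / 1 := div_le_div_of_nonneg_left hρ₀pos.le one_pos (by linarith)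
        _ = ρ₀ := div_one _
    exact (pow_le_pow_left₀ hr₀pos.le h1 2).trans hρ₀sqT
  refine ⟨θ, hθpos, r₀, hr₀pos, ?_, ?_⟩
  · calc θ ^ 2 * r₀ ^ 2 ≤ 1 * r₀ ^ 2 :=
          mul_le_mul_of_nonneg_right (pow_le_one₀ hθpos.le hθ1) (sq_nonneg _)
      _ < T := by linarith
  intro r hr t ht
  have hr0 : 0 < r := hr.1
  have hrr₀ : r ≤ r₀ := hr.2
  have hθr : θ ^ 2 * r ^ 2 ≤ T / 4 := by
    calc θ ^ 2 * r ^ 2 ≤ 1 * r ^ 2 :=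
          mul_le_mul_of_nonneg_right (pow_le_one₀ hθpos.le hθ1) (sq_nonneg _)
      _ ≤ 1 * r₀ ^ 2 := by rw [one_mul, one_mul]; exact pow_le_pow_left₀ hr0.le hrr₀ 2
      _ ≤ T / 4 := by rw [one_mul]; exact hr₀T
  -- geometry of the scales
  have hLr : L * r ≤ 1 / 6 := by
    calc L * r ≤ L * (1 / (6 * L)) := mul_le_mul_of_nonneg_left (hrr₀.trans hr₀L) hL0.le
      _ = 1 / 6 := by field_simp
  have h3Lr : 3 * L * r ≤ 1 / 2 := by linarith
  have h4Lr : 4 * L * r ≤ ρ₀ / 2 := by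
    calc 4 * L * r ≤ 4 * L * (ρ₀ / (8 * L)) :=
          mul_le_mul_of_nonneg_left (hrr₀.trans hr₀ρ) (by positivity)
      _ = ρ₀ / 2 := by field_simp; ring
  have hKr : K * r ^ 2 ≤ δ :=
    (mul_le_mul_of_nonneg_left (pow_le_pow_left₀ hr0.le hrr₀ 2) hK).trans hr₀K
  -- frequent largeness near `T` at the scale `r`
  have hfreq' : ∀ t' < T, ∃ t ∈ Ioo t' T,
      δ < ∫ x, ‖u t x‖ ^ 2 * (r⁻¹ * Pb (‖x - x₀‖ ^ 2 / r ^ 2)) := by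
    intro t' ht'
    obtain ⟨t, ht, hgt⟩ := hfreq T u p hT hsol hLH K hK hone x₀ hsing r (max t' 0) hr0
      (le_max_right _ _) (max_lt ht' hT) hKr
    exact ⟨t, ⟨(le_max_left _ _).trans_lt ht.1, ht.2⟩, hgt⟩
  clear hfreq
  -- no upward jump larger than `δ/2` over windows of length `θ² r²` below `T`
  have hwindow : ∀ t₀ t₁, T - θ ^ 2 * r ^ 2 < t₀ → t₀ ≤ t₁ → t₁ < T → t₁ - t₀ ≤ θ ^ 2 * r ^ 2 →
      (∫ x, ‖u t₁ x‖ ^ 2 * (r⁻¹ * Pb (‖x - x₀‖ ^ 2 / r ^ 2))) - δ / 2 ≤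
        ∫ x, ‖u t₀ x‖ ^ 2 * (r⁻¹ * Pb (‖x - x₀‖ ^ 2 / r ^ 2)) := by
    intro t₀ t₁ ht₀ ht₀₁ ht₁ hlen
    have ht₀pos : 0 < t₀ := by linarith
    have hj := hjump hT hsol hLH hK hone x₀ hK₁ hMF hc₃ hc₄ hr0 h3Lr h4Lr hθpos hθ1 ht₀pos ht₀
      ht₀₁ ht₁ hlen
    have htail : (L ^ 2)⁻¹ * MF ≤ δ / 8 := by
      rw [inv_mul_le_iff₀ (by positivity)]; linarith [hLtail]
    rw [← hA₁, ← hA₂, ← hA₃] at hj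
    linarith [hj, htail, hsmall]
  have hmain : δ - δ / 2 ≤ ∫ x, ‖u t x‖ ^ 2 * (r⁻¹ * Pb (‖x - x₀‖ ^ 2 / r ^ 2)) :=
    le_of_frequently_gt_of_window (ε := δ / 2) (η := θ ^ 2 * r ^ 2) (τ := θ ^ 2 * r ^ 2)
      hfreq' hwindow t (by rwa [min_self])
  linarith

end SereginSverak2002

end Literature.Analysis.FluidPDE

end
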